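import Literature.MathematicalPhysics.QuantumFieldTheory.Balaban1983to89.B3Sect2ThreeLegTwoVertex

/-!
# `Balaban1983to89.B3Sect2ThreeLegThreeVertex` — T. Bałaban, *(Higgs)₂,₃ quantum fields in a finite volume. III. Renormalization*,
Commun. Math. Phys. **88** (1983) 411–445 [Balaban1983Higgs3]: p. 430 *"In fact the only other divergent graphs of this class are:
(2.21)"* — the THREE-VERTEX graphs of the class (two external scalar legs, one external vector leg) DECIDED on the concrete family
`B3Cor23Concrete.Graph` (d = 3), and the exhaustion of the class by the two- and three-vertex cases

statement-level skeleton of published theorems with citation tags; proofs where landed; nothing here is a claim about the Yang–Mills mass gap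

PDF held: `paper:balaban1983-higgs-2-3-quantum-fields-finite-volume` (journal page = PDF page + 410); displays (2.20), (2.21) read as
images (strip crops): `…/b2b-balaban-ref1/pages/1983-cmp88-higgs23-III/1983-cmp88-higgs23-III-p019, p020-x2.png` (pp. 429, 430).
CITATION HEADER (lean-in-tree rule).  lit-balaban TYPED SKELETON (HOME `run/shared/lean/pub/lit-balaban/`), Phase 2, seat p18 (gen 3),
unit `lit-balaban-p18`; SKELETON row **B3.Eq2.18-2.22** (fold owner r15) and HOME/GAPS.md **G-B3-03**.  Sibling `…B3Sect2ThreeLegTwoVertex`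
(two vertices; `SelfLine`, `other_inj`); inputs `B3Sect3DivergentClasses.threeLeg_structure` (p248510), `B3Sect3DegreeCensus` (p248239);
pictures as model graphs `B3Sect2ThreeLegGraphs` (p248628: `g220`, `g221b`, `g221c`, `gX2`).

WHAT THIS MODULE PROVES (d = 3, n̄ ≥ 2; sorry-free; theorems only).  `threeLeg_threeVertices`: a graph of the model with D(G) ≤ 0, two
external φ′-legs, one external vector leg and THREE vertices consists of u = (1.8) with n + n′ = 1 (no internal A′-leg: it carries the
external vector leg) and b, c = (1.8)_{1,0} with one internal A′-leg each (the A′-line), every differentiation internal, and its two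
φ′-lines realize exactly one of: **(2.20)** (both φ′-legs of u internal, no tadpole at u — they end at b and c), **(2.21b)** (the
differentiated leg of u joined to the undifferentiated leg of the vertex b carrying two internal φ′-legs, no tadpole at b), **(2.21c)**
(joined to the differentiated leg of b), **X2** of G-B3-03 (a φ′-tadpole at b; then u is joined to c), or the disconnected
configuration (φ′-tadpole at u next to the graph (2.4) on b, c).  `threeLeg_cases`: two vertices without (1.6), two vertices with one
(1.6), or three vertices without (1.6) — so with `…TwoVertex` the class is, on the model and up to the relabelling of vertices and the
A′∕Ã reading of the external vector leg, exactly the nine pictures (2.18)–(2.21f), X1, X2 and two disconnected unions of lower-order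
graphs: the printed «only … (2.21)» misses X1 and X2 (G-B3-03, now kernel-checked), nothing else.  Helpers: `three_vertices`,
`not_selfLine_of_intScalar_eq_one`.  NOT here: 1PI / connectedness as hypotheses; the analytic content of the class (Sect. 3).
-/

namespace Literature.MathematicalPhysics.QuantumFieldTheory.Balaban1983to89.B3Sect2ThreeLegThreeVertex

open Finset B3Prop1 B3Sect2Statements B3VertexBridge B3Cor23Concrete B3DivergentGraphs B3ScalarLegParity B3OddVectorLoops
  B3Sect3DegreeCensus B3Sect3DivergentClasses
  B3Sect2ThreeLegTwoVertex

variable {nbar : ℕ} (G : Graph nbar)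

/-- kernel: the three vertices of a three-vertex graph and the sums over them. [cite: Balaban1983Higgs3, p.415] -/
theorem three_vertices (hV : G.nV = 3) :
    ∃ i₀ i₁ i₂ : Fin G.nV, i₀ ≠ i₁ ∧ i₀ ≠ i₂ ∧ i₁ ≠ i₂ ∧ (∀ i, i = i₀ ∨ i = i₁ ∨ i = i₂) ∧
      ∀ f : Fin G.nV → ℕ, ∑ i, f i = f i₀ + f i₁ + f i₂ := by
  refine ⟨⟨0, by omega⟩, ⟨1, by omega⟩, ⟨2, by omega⟩, by simp [Fin.ext_iff], by simp [Fin.ext_iff], by simp [Fin.ext_iff],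
    fun i => ?_, fun f => ?_⟩
  · have := i.isLt
    rcases Nat.lt_or_ge i.val 1 with h | h
    · exact Or.inl (Fin.ext (by simp; omega))
    · rcases Nat.lt_or_ge i.val 2 with h' | h'
      · exact Or.inr (Or.inl (Fin.ext (by simp; omega)))
      · exact Or.inr (Or.inr (Fin.ext (by simp; omega)))
  · have huniv : (univ : Finset (Fin G.nV)) = {⟨0, by omega⟩, ⟨1, by omega⟩, ⟨2, by omega⟩} := by
      ext i; simp only [mem_univ, mem_insert, mem_singleton, true_iff, Fin.ext_iff]; have := i.isLt; omega
    rw [huniv, sum_insert (by simp [Fin.ext_iff]), sum_pair (by simp [Fin.ext_iff]), add_assoc]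

/-- kernel: a vertex with exactly one internal φ′-leg carries no φ′-tadpole. [cite: Balaban1983Higgs3, p.415] -/
theorem not_selfLine_of_intScalar_eq_one {i : Fin G.nV} (h1 : G.intScalar i = 1) (hiv : G.intVector i = 0) :
    ¬ SelfLine G i := by
  rintro ⟨⟨i', x⟩, y, hx, hxy, hy⟩
  dsimp only at hx
  subst hx
  cases x with
  | inl j =>
    obtain ⟨i'', j'', hyv, hback⟩ := G.other_scalar hxy
    subst hyv
    dsimp only at hy
    subst hy
    have hne : j ≠ j'' := by rintro rfl; exact G.other_ne _ _ hxy rfl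
    have := two_le_intScalar G j j'' hne (by simp [hxy]) (by simp [hback])
    omega
  | inr j =>
    have := G.one_le_intVector j (by simp [hxy])
    omega

/-- The three-vertex divergent graphs with two external scalar legs and one external vector leg, d = 3, n̄ ≥ 2 — DECIDED on the
model: the vertices are u = (1.8) with n + n′ = 1 (no internal A′-leg; it carries the external vector leg) and b, c = (1.8)_{1,0}
joined by the A′-line; every differentiation is internal; and the two φ′-lines realize (2.20) (both legs of u internal, joined to b
and to c), (2.21b)/(2.21c) (the leg of u joined to the undifferentiated / the differentiated leg of the vertex b carrying two
internal φ′-legs, the remaining legs of b and c joined), X2 of HOME/GAPS.md G-B3-03 (the leg of u joined to c, a φ′-tadpole at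
b), or the disconnected configuration (φ′-tadpole at u next to the graph (2.4) on b, c). [cite: Balaban1983Higgs3, (2.21) p.430] -/
theorem threeLeg_threeVertices (hn : 2 ≤ nbar) (hD : G.deg 3 ≤ 0) (hs : numExtScalarLegs G = 2)
    (hv : numExtVectorLegs G + numTildeLegs G = 1) (hV : G.nV = 3) :
    ∃ u b c : Fin G.nV, u ≠ b ∧ u ≠ c ∧ b ≠ c ∧
      (G.kind u = .v18 0 1 ∨ G.kind u = .v18 1 0) ∧ G.kind b = .v18 1 0 ∧ G.kind c = .v18 1 0 ∧
      G.intVector u = 0 ∧ G.intVector b = 1 ∧ G.intVector c = 1 ∧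
      G.intDiffs u = 1 ∧ G.intDiffs b = 1 ∧ G.intDiffs c = 1 ∧
      ( -- (2.20)
        (G.intScalar u = 2 ∧ G.intScalar b = 1 ∧ G.intScalar c = 1 ∧ ¬ SelfLine G u) ∨
        -- disconnected: φ′-tadpole at u, the graph (2.4) on b, c
        (G.intScalar u = 2 ∧ G.intScalar b = 1 ∧ G.intScalar c = 1 ∧ SelfLine G u) ∨
        -- X2: the leg of u joined to c, φ′-tadpole at b
        (G.intScalar u = 1 ∧ G.intScalar b = 2 ∧ G.intScalar c = 1 ∧ SelfLine G b) ∨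
        -- (2.21b): the (differentiated) leg of u joined to the undifferentiated leg 1 of b
        (G.intScalar u = 1 ∧ G.intScalar b = 2 ∧ G.intScalar c = 1 ∧ ¬ SelfLine G b ∧
          ∃ (h0 : 0 < (G.kind u).scalarLegs) (h1 : 1 < (G.kind b).scalarLegs),
            G.other ⟨u, .inl ⟨0, h0⟩⟩ = some ⟨b, .inl ⟨1, h1⟩⟩) ∨
        -- (2.21c): the leg of u joined to the differentiated leg 0 of b
        (G.intScalar u = 1 ∧ G.intScalar b = 2 ∧ G.intScalar c = 1 ∧ ¬ SelfLine G b ∧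
          ∃ (h0 : 0 < (G.kind u).scalarLegs) (h0' : 0 < (G.kind b).scalarLegs),
            G.other ⟨u, .inl ⟨0, h0⟩⟩ = some ⟨b, .inl ⟨0, h0'⟩⟩)) := by
  have hG := not_hasVertex1315_of_deg_nonpos G hD
  obtain ⟨h17, hX, hbr⟩ := threeLeg_structure G hD hs hv
  obtain ⟨hiv, h16⟩ : numIntVectorLegs G = 2 ∧ numV16 G = 0 := by
    rcases hbr with ⟨h, h', -, -⟩ | ⟨-, -, h⟩
    · exact ⟨h, h'⟩
    · omega
  have hsc := two_nV_add_eq G hG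
  have heo := eOrder_eq G
  have hvl := sum_vectorLegs_eq G
  obtain ⟨i₀, i₁, i₂, h01, h02, h12, hall, hsum⟩ := three_vertices G hV
  have hS := hsum G.intScalar
  have hIV : numIntVectorLegs G = G.intVector i₀ + G.intVector i₁ + G.intVector i₂ := hsum G.intVector
  have hVL := hsum fun j => (G.kind j).vectorLegs
  have hDV := hsum fun j => (G.kind j).dv
  rw [← eOrder] at hDV
  have hT := hsum fun j => (G.kind j).extVectorLegs
  change numTildeLegs G = _ at hT
  have hdiff : ∀ i, G.intDiffs i = (G.kind i).diffCount := fun i => by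
    have := (sum_eq_zero_iff.mp hX) i (mem_univ i); have := G.intDiffs_le i; omega
  -- every vertex is (1.8) with n + n′ = 1
  have hk : ∀ i, ∃ n t, n + t = 1 ∧ G.kind i = .v18 n t ∧ G.intVector i ≤ n ∧ 1 ≤ G.intScalar i ∧ G.intScalar i ≤ 2 ∧
      G.intDiffs i = 1 := by
    have hdv1 : ∀ i, 1 ≤ (G.kind i).dv := fun i => by
      rcases kind_cases_tilde_le_two hn (G.kind i) (G.adm i) (isOfForm1315_eq_false G hG i) (kind_ne_v16 G h16 i)
          (kind_ne_v17 G h17 i) ((extVectorLegs_le G i).trans (by omega)) with ⟨n, t, hnt, hk⟩ | ⟨n, t, hnt, hk⟩ <;>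
        rw [hk] <;> simp [VertexKind.dv] <;> omega
    intro i
    have hdv : (G.kind i).dv = 1 := by
      have h0 := hdv1 i₀; have h1 := hdv1 i₁; have h2 := hdv1 i₂
      rcases hall i with rfl | rfl | rfl <;> omega
    have hdi := hdiff i
    have h3 := G.intScalar_le i
    have h1 := G.intVector_le i
    have h5 := B3Cor23ConcreteTwoDim.intDiffs_le_intScalar G i
    rcases kind_cases_tilde_le_two hn (G.kind i) (G.adm i) (isOfForm1315_eq_false G hG i) (kind_ne_v16 G h16 i)
        (kind_ne_v17 G h17 i) ((extVectorLegs_le G i).trans (by omega)) with ⟨n, t, hnt, hk⟩ | ⟨n, t, hnt, hk⟩ <;>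
      rw [hk] at hdi h3 h1 hdv ⊢ <;>
      simp only [VertexKind.scalarLegs, VertexKind.diffCount, VertexKind.dv, VertexKind.vectorLegs] at hdi h3 h1 hdv ⊢
    · exact ⟨n, t, hdv, rfl, h1, by omega, h3, hdi⟩
    · omega
  -- name u (no internal A′-leg) and b, c (joined by the A′-line)
  have main : ∀ u b c : Fin G.nV, u ≠ b → u ≠ c → b ≠ c → (∀ i, i = u ∨ i = b ∨ i = c) →
      G.intVector u = 0 → G.intScalar c ≤ G.intScalar b →
      G.intScalar u + G.intScalar b + G.intScalar c = 4 → G.intVector u + G.intVector b + G.intVector c = 2 →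
      (G.kind u = .v18 0 1 ∨ G.kind u = .v18 1 0) ∧ G.kind b = .v18 1 0 ∧ G.kind c = .v18 1 0 ∧
      G.intVector u = 0 ∧ G.intVector b = 1 ∧ G.intVector c = 1 ∧
      G.intDiffs u = 1 ∧ G.intDiffs b = 1 ∧ G.intDiffs c = 1 ∧
      ( (G.intScalar u = 2 ∧ G.intScalar b = 1 ∧ G.intScalar c = 1 ∧ ¬ SelfLine G u) ∨
        (G.intScalar u = 2 ∧ G.intScalar b = 1 ∧ G.intScalar c = 1 ∧ SelfLine G u) ∨
        (G.intScalar u = 1 ∧ G.intScalar b = 2 ∧ G.intScalar c = 1 ∧ SelfLine G b) ∨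
        (G.intScalar u = 1 ∧ G.intScalar b = 2 ∧ G.intScalar c = 1 ∧ ¬ SelfLine G b ∧
          ∃ (h0 : 0 < (G.kind u).scalarLegs) (h1 : 1 < (G.kind b).scalarLegs),
            G.other ⟨u, .inl ⟨0, h0⟩⟩ = some ⟨b, .inl ⟨1, h1⟩⟩) ∨
        (G.intScalar u = 1 ∧ G.intScalar b = 2 ∧ G.intScalar c = 1 ∧ ¬ SelfLine G b ∧
          ∃ (h0 : 0 < (G.kind u).scalarLegs) (h0' : 0 < (G.kind b).scalarLegs),
            G.other ⟨u, .inl ⟨0, h0⟩⟩ = some ⟨b, .inl ⟨0, h0'⟩⟩)) := by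
    intro u b c hub huc hbc hall3 hu0 hcb hS4 hIV2
    obtain ⟨nu, tu, hntu, hku, hivu, hsu1, hsu2, hdu⟩ := hk u
    obtain ⟨nb, tb, hntb, hkb, hivb, hsb1, hsb2, hdb⟩ := hk b
    obtain ⟨nc, tc, hntc, hkc, hivc, hsc1, hsc2, hdc⟩ := hk c
    have hivb1 : G.intVector b = 1 := by omega
    have hivc1 : G.intVector c = 1 := by omega
    obtain ⟨rfl, rfl⟩ : nb = 1 ∧ tb = 0 := by omega
    obtain ⟨rfl, rfl⟩ : nc = 1 ∧ tc = 0 := by omega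
    have hku' : G.kind u = .v18 0 1 ∨ G.kind u = .v18 1 0 := by
      rcases Nat.lt_or_ge nu 1 with h | h
      · left; have : nu = 0 := by omega
        subst this; have : tu = 1 := by omega
        subst this; exact hku
      · right; have : nu = 1 := by omega
        subst this; have : tu = 0 := by omega
        subst this; exact hku
    refine ⟨hku', hkb, hkc, hu0, hivb1, hivc1, hdu, hdb, hdc, ?_⟩
    rcases Nat.lt_or_ge (G.intScalar u) 2 with hult | huge
    · -- intScalar u = 1, hence b carries two internal φ′-legs and c one
      have hsu : G.intScalar u = 1 := by omega
      have hsb : G.intScalar b = 2 := by omega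
      have hscc : G.intScalar c = 1 := by omega
      right; right
      by_cases hselfb : SelfLine G b
      · -- X2
        left; exact ⟨hsu, hsb, hscc, hselfb⟩
      · right
        -- the partner of u's differentiated leg lies at b
        obtain ⟨h0u, hsome⟩ := B3Graph24Unique.isSome_of_intDiffs_pos G (i := u) (by omega)
        obtain ⟨y, hy⟩ := Option.isSome_iff_exists.mp hsome
        obtain ⟨v, k, hyv, hback⟩ := G.other_scalar hy
        subst hyv
        -- u carries exactly one internal φ′-leg, its leg 0
        have honly : ∀ (j' : Fin (G.kind u).scalarLegs), (G.other ⟨u, .inl j'⟩).isSome → j' = ⟨0, h0u⟩ := by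
          intro j' hj'
          by_contra hne'
          have := two_le_intScalar G j' ⟨0, h0u⟩ hne' hj' hsome
          omega
        have hvu : v ≠ u := fun hvu' => not_selfLine_of_intScalar_eq_one G hsu hu0 ⟨_, _, rfl, hy, hvu'⟩
        have hvc : v ≠ c := by
          intro hvc
          subst hvc
          apply hselfb
          -- the internal φ′-legs of b pair with each other
          obtain ⟨j, hj⟩ := G.exists_of_one_le_intScalar (i := b) (by omega)
          obtain ⟨z, hz⟩ := Option.isSome_iff_exists.mp hj
          obtain ⟨w, j', hzw, hzb⟩ := G.other_scalar hz
          subst hzw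
          refine ⟨⟨b, .inl j⟩, ⟨w, .inl j'⟩, rfl, hz, ?_⟩
          change w = b
          rcases hall3 w with hwu | hwb | hwc
          · exfalso
            subst hwu
            have hj0 := honly j' (by simp [hzb])
            subst hj0
            rw [hy] at hzb
            have h1 := congrArg Sigma.fst (Option.some.inj hzb)
            exact hbc h1.symm
          · exact hwb
          · exfalso
            subst hwc
            by_cases hjk : j' = k
            · subst hjk
              rw [hback] at hzb
              have h1 := congrArg Sigma.fst (Option.some.inj hzb)
              exact hub h1
            · have := two_le_intScalar G j' k hjk (by simp [hzb]) (by simp [hback])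
              omega
        have hvb : v = b := by
          rcases hall3 v with h | h | h
          · exact absurd h hvu
          · exact h
          · exact absurd h hvc
        subst hvb
        have hk2 : (k : ℕ) < 2 := by
          have h := k.isLt
          have e : (G.kind v).scalarLegs = 2 := by rw [hkb]; rfl
          omega
        rcases Nat.lt_or_ge (k : ℕ) 1 with hk0 | hk1
        · -- (2.21c): joined to the differentiated leg 0 of b
          right
          have h0b : 0 < (G.kind v).scalarLegs := by rw [hkb]; decide
          refine ⟨hsu, hsb, hscc, hselfb, h0u, h0b, ?_⟩
          have hkk : k = ⟨0, h0b⟩ := Fin.ext (by simp; omega)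
          rw [hy, hkk]
        · -- (2.21b): joined to the undifferentiated leg 1 of b
          left
          have h1b : 1 < (G.kind v).scalarLegs := by rw [hkb]; decide
          refine ⟨hsu, hsb, hscc, hselfb, h0u, h1b, ?_⟩
          have hkk : k = ⟨1, h1b⟩ := Fin.ext (by simp; omega)
          rw [hy, hkk]
    · -- intScalar u = 2: (2.20) or the disconnected configuration
      have hsu : G.intScalar u = 2 := by omega
      by_cases hself : SelfLine G u
      · right; left; exact ⟨hsu, by omega, by omega, hself⟩
      · left; exact ⟨hsu, by omega, by omega, hself⟩
  -- choose u with no internal A′-leg, order b, c by their internal φ′-legs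
  have hS4 : G.intScalar i₀ + G.intScalar i₁ + G.intScalar i₂ = 4 := by omega
  have hIV2 : G.intVector i₀ + G.intVector i₁ + G.intVector i₂ = 2 := by omega
  have hle1 : ∀ i, G.intVector i ≤ 1 := fun i => by obtain ⟨n, t, hnt, -, h, -⟩ := hk i; omega
  have h0 := hle1 i₀; have h1 := hle1 i₁; have h2 := hle1 i₂
  have hall' : ∀ i, i = i₁ ∨ i = i₀ ∨ i = i₂ := fun i => by rcases hall i with h | h | h <;> simp [h]
  have hall'' : ∀ i, i = i₂ ∨ i = i₀ ∨ i = i₁ := fun i => by rcases hall i with h | h | h <;> simp [h]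
  have swap : ∀ u b c : Fin G.nV, (∀ i, i = u ∨ i = b ∨ i = c) → ∀ i, i = u ∨ i = c ∨ i = b :=
    fun u b c h i => by rcases h i with h' | h' | h' <;> simp [h']
  rcases Nat.lt_or_ge (G.intVector i₀) 1 with hi0 | hi0
  · rcases Nat.le_total (G.intScalar i₂) (G.intScalar i₁) with hcb | hcb
    · exact ⟨i₀, i₁, i₂, h01, h02, h12, main i₀ i₁ i₂ h01 h02 h12 hall (by omega) hcb hS4 hIV2⟩
    · exact ⟨i₀, i₂, i₁, h02, h01, h12.symm,
        main i₀ i₂ i₁ h02 h01 h12.symm (swap _ _ _ hall) (by omega) hcb (by omega) (by omega)⟩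
  · rcases Nat.lt_or_ge (G.intVector i₁) 1 with hi1 | hi1
    · rcases Nat.le_total (G.intScalar i₂) (G.intScalar i₀) with hcb | hcb
      · exact ⟨i₁, i₀, i₂, h01.symm, h12, h02, main i₁ i₀ i₂ h01.symm h12 h02 hall' (by omega) hcb (by omega) (by omega)⟩
      · exact ⟨i₁, i₂, i₀, h12, h01.symm, h02.symm,
          main i₁ i₂ i₀ h12 h01.symm h02.symm (swap _ _ _ hall') (by omega) hcb (by omega) (by omega)⟩
    · rcases Nat.le_total (G.intScalar i₁) (G.intScalar i₀) with hcb | hcb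
      · exact ⟨i₂, i₀, i₁, h02.symm, h12.symm, h01,
          main i₂ i₀ i₁ h02.symm h12.symm h01 hall'' (by omega) hcb (by omega) (by omega)⟩
      · exact ⟨i₂, i₁, i₀, h12.symm, h02.symm, h01.symm,
          main i₂ i₁ i₀ h12.symm h02.symm h01.symm (swap _ _ _ hall'') (by omega) hcb (by omega) (by omega)⟩

/-- kernel: the three structure theorems above exhaust the class — a divergent graph with two external scalar legs and one
external vector leg (d = 3) has two vertices and no vertex (1.6) (`threeLeg_twoVertices`), two vertices one of which is (1.6)
(`threeLeg_twoVertices_phi4`), or three vertices and no vertex (1.6) (`threeLeg_threeVertices`).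
[cite: Balaban1983Higgs3, (2.21) p.430] -/
theorem threeLeg_cases (hD : G.deg 3 ≤ 0) (hs : numExtScalarLegs G = 2) (hv : numExtVectorLegs G + numTildeLegs G = 1) :
    (G.nV = 2 ∧ numV16 G = 0) ∨ (G.nV = 2 ∧ numV16 G = 1) ∨ (G.nV = 3 ∧ numV16 G = 0) := by
  obtain ⟨-, -, hbr⟩ := threeLeg_structure G hD hs hv
  omega

end Literature.MathematicalPhysics.QuantumFieldTheory.Balaban1983to89.B3Sect2ThreeLegThreeVertex
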